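import Literature.Probability.Percolation.KestenScaling
import HarnessLib

/-!
# `χ(p) = |p - 1/2|^{-43/18 + o(1)}` from `χ ≍ L² π₁(L)²`, Kesten's relation and the two arm exponents (assembly)

Topic `Literature/Probability/Percolation`; family `crit-perc`, statement **crit-perc.S16**, named fact
`Literature.Probability.Percolation.triMeanClusterSize_exponent` (`ArmExponents.lean`): for site
percolation on the triangular lattice the finite-cluster mean size
`χ^f(p) = E_p[|C(0)|; |C(0)| < ∞]` satisfies `χ^f(p) = |p - 1/2|^{-43/18 + o(1)}` as `p → 1/2` from
either side (Smirnov–Werner, *Math. Res. Lett.* **8** (2001), §2, theorem "Behaviour near the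
critical point", item (ii) [Thm. 1 (ii) of arXiv:math/0109120]: "when `p → 1/2`,
`χ(p) = (p - 1/2)^{-43/18 + o(1)}`", `χ(p) = E_p[N 1_{N < ∞}]`; via Kesten, *Comm. Math. Phys.*
**109** (1987)). Proofs only: this file introduces no definition and no named fact; it PROVES the
last step of the printed proof, in the style of `KestenScaling.triTheta_exponent_of_scaling_at`
(`β = 5/36`) and `KestenScaling.hasRightPowerLaw_charLength_at` (`ν = 4/3`).

## The printed proof (Nolin, *Electron. J. Probab.* **13** (2008), §7.5 [arXiv 0711.4948, §7.5])

Nolin §7.5, "Critical exponents for `χ` and `ξ`", Proposition 43 of arXiv 0711.4948 (the `t = 0`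
case of the "main estimate", Lemma 42 loc. cit.):
`χ(p) = E_p[|C(0)|; |C(0)| < ∞] ≍ L(p)² π₁²(L(p))` uniformly in `p`, where `L(p) = L_ε(p)` is the
finite-size-scaling characteristic length (any fixed `ε ∈ (0, 1/2)`, §7.1 and Cor. 35 loc. cit.)
and `π₁(N) = P_{1/2}(0 ↔ ∂S_N)`; and then the display following it:
`χ(p) ≈ L(p)² [L(p)^{-5/48}]² ≈ [|p - 1/2|^{-4/3}]^{86/48} ≈ |p - 1/2|^{-43/18}`, which uses the
one-arm exponent `α₁ = 5/48` (Lawler–Schramm–Werner 2002; the tree's `oneArm_exponent`) and the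
exponent `4/3` of `L_ε` (§7.3 loc. cit.: Kesten's relation `|p - 1/2| L_ε(p)² π₄(L_ε(p)) ≍ 1`,
Prop. 32 of the arXiv text = the tree's `Nolin2008_prop34`, together with the four-arm exponent
`α₄ = 5/4`, the tree's `fourArm_exponent`; proved in the tree as
`KestenScaling.tendsto_log_charLength_div_log_at`).

This file proves exactly that display, as pure real analysis on the log-ratio limits of
`CorrelationDecay.lean`:

* `tendsto_log_triMeanClusterSize_div_log_at`: from `oneArm_exponent`, `fourArm_exponent`, Kesten's
  relation at one `ε` (the body of `Nolin2008_prop34` at `ε`) and the two-sided bound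
  `c L_ε(p)² π₁(L_ε(p))² ≤ χ^f(p) ≤ C L_ε(p)² π₁(L_ε(p))²` on a punctured neighbourhood of `1/2`
  (the body of Nolin's Prop. 43 at `ε`, an explicit hypothesis — NOT a new named fact),
  `log χ^f(p) / log |p - 1/2| → -43/18` as `p → 1/2`, `p ≠ 1/2`;
* `triMeanClusterSize_exponent_of_scaling_at`: hence `triMeanClusterSize_exponent` (both one-sided
  power laws, `log |p - 1/2| = log (p - 1/2)` resp. `= log (1/2 - p)`);
* `triMeanClusterSize_exponent_of_scaling`: the same with Kesten's relation `Nolin2008_prop34` and the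
  `χ`-bound for all `ε ∈ (0, 1/2)`, specialised at `ε = 1/4`.

What remains for `triMeanClusterSize_exponent_holds` (recorded for the literature-prover): the leaves
`oneArm_exponent`, `fourArm_exponent`, `Nolin2008_prop34` (named facts of the tree, each a theory of
its own) and Nolin's Prop. 43 itself, whose printed proof (Lemmas 41–42 of arXiv 0711.4948: the
near-critical stability of one arm `Nolin2008_thm27_oneArm`, extendability and quasi-multiplicativity
of `π₁`, the a priori bound `π₁(n|N) ≥ C (n/N)^{1/2}`, RSW circuits and FKG below `L(p)`, and the
uniform exponential decay `Nolin2008_lemma39` above `L(p)`) is to be formalised from the tree's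
near-critical files.

## Conventions and faithfulness notes

* As in `KestenScaling.lean`: `L_ε(p)` is `charLength ε p` (rhombus crossings at the sub-critical
  parameter, `L_ε(p) = L_ε(1 - p)`), `π₁(N)` is `critOneArmProb N = P_{1/2}(0 ↔ ∂Λ_N)` on the graph
  balls `Λ_N = triBall N` of `𝕋` (Nolin's `S_N` is the rhombus, `Λ_N ⊆ S_N ⊆ Λ_{2N}`; by
  extendability, Prop. 15 of the arXiv text, `π₁(N) ≍ π₁(2N)`, so the `≍`-statement is the same).
* Nolin's "uniformly in `p`" `≍` (§2.1) is rendered, as for the facts of `KestenScaling.lean`, by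
  two-sided bounds with positive constants on a punctured neighbourhood of `1/2` — weaker than
  printed and exactly what the assembly consumes. The bound is stated in `ℝ≥0∞`, where
  `triMeanClusterSize p = χ^f(p)` lives (`ArmEvents.lean`); it entails `χ^f(p) < ∞` there (Kesten
  1987, (1.16)), so that the `ENNReal.toReal` in `triMeanClusterSize_exponent` takes no junk value.
* `χ^f` versus `χ`: Nolin's and Smirnov–Werner's `χ(p)` IS the finite-cluster mean size
  `E_p[|C(0)|; |C(0)| < ∞]` (Nolin §7.2; Smirnov–Werner §2), i.e. the tree's `triMeanClusterSize`.
* Numbering: items of Nolin's paper are cited by the numbers of arXiv:0711.4948v1 (the text read: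
  §7.5, Lemma 41, Lemma 42, Prop. 43; §7.3, Prop. 32), flagged as such; the published EJP numbering
  is shifted (EJP Prop. 34 = arXiv Prop. 32, see `KestenScaling.lean`). Kesten's original paper
  (CMP **109** (1987)) is not held by the library (acquisition requested); Smirnov–Werner, §2:
  "It has been shown by Kesten in [Kpaper] ... that all these results hold provided that
  `P[A¹_R] = R^{-5/48 + o(1)}` and `P[A²_R] = R^{-5/4 + o(1)}`".

## References

* S. Smirnov, W. Werner, Critical exponents for two-dimensional percolation, *Math. Res. Lett.*
  8 (2001) 729–744, §2, Thm. 1 (ii) of arXiv:math/0109120 [SmirnovWernerMRL2001].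
* P. Nolin, Near-critical percolation in two dimensions, *Electron. J. Probab.* 13 (2008)
  1562–1623, §7.5 [Nolin2008].
* H. Kesten, Scaling relations for 2D-percolation, *Comm. Math. Phys.* 109 (1987) 109–156
  [KestenScalingCMP1987].
* G. F. Lawler, O. Schramm, W. Werner, One-arm exponent for critical 2D percolation, *Electron. J.
  Probab.* 7 (2002) [LawlerSchrammWernerEJP2002].

## Mathlib / tree

Only real analysis (`Real.log`, `Filter.Tendsto`, `nhdsWithin`, `ENNReal.toReal`) is used; Mathlib
has no percolation. Tree: `tendsto_charLength_atTop_at`, `tendsto_log_charLength_div_log_at`,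
`hasDecayExponent_eventually_pos`, `eventually_nhdsNE_half`, `tendsto_sub_half_nhdsNE`
(`KestenScaling.lean`).
-/

noncomputable section

open Filter Topology MeasureTheory Set
open scoped unitInterval ENNReal

namespace Literature.Probability.Percolation

open LatticeModels

/-! ### `γ = 2 ν (1 - α₁) = 2 · (4/3) · (43/48) = 43/18`, two-sided -/

/-- **`log χ^f(p) / log |p - 1/2| → -43/18` as `p → 1/2`, `p ≠ 1/2`** (Nolin 2008, §7.5, display
after Prop. 43 of arXiv 0711.4948: `χ(p) ≈ L(p)² [L(p)^{-5/48}]² ≈ [|p - 1/2|^{-4/3}]^{86/48} ≈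
|p - 1/2|^{-43/18}`; Smirnov–Werner 2001, §2, Thm. 1 (ii)), from the one-arm exponent `5/48`
(`oneArm_exponent`), the four-arm exponent `5/4` (`fourArm_exponent`), Kesten's relation
`|p - 1/2| L_ε² π₄(L_ε) ≍ 1` at the given `ε` (the body of `Nolin2008_prop34` at `ε`) and Nolin's
Prop. 43 at `ε`: `c L_ε(p)² π₁(L_ε(p))² ≤ χ^f(p) ≤ C L_ε(p)² π₁(L_ε(p))²` for `p ≠ 1/2` near `1/2`
(hypothesis `hχ`, in `ℝ≥0∞`). Proof as printed: `log χ^f = 2 log L + 2 log π₁(L) + O(1)`,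
`log π₁(L) / log L → -5/48`, `log L / log |p - 1/2| → -4/3`, whence
`2 · (-4/3) + 2 · (-5/48) · (-4/3) = -43/18`. [cite: Nolin2008, §7.5, Prop. 43 and the display after it (arXiv 0711.4948 numbering)] [cite: SmirnovWernerMRL2001, §2, Thm. 1 (ii) (arXiv:math/0109120)] -/
theorem tendsto_log_triMeanClusterSize_div_log_at {ε : ℝ} (h₁ : oneArm_exponent)
    (h₄ : fourArm_exponent)
    (hK : ∃ r₁ : ℕ, ∀ r₀ ≥ r₁, ∃ δ > (0 : ℝ), ∃ c > (0 : ℝ), ∃ C : ℝ,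
      ∀ p : unitInterval, (p : ℝ) ≠ 1 / 2 → |(p : ℝ) - 1 / 2| < δ →
        c ≤ |(p : ℝ) - 1 / 2| * (charLength ε p : ℝ) ^ 2 * critFourArmProb r₀ (charLength ε p) ∧
          |(p : ℝ) - 1 / 2| * (charLength ε p : ℝ) ^ 2 * critFourArmProb r₀ (charLength ε p) ≤ C)
    (hχ : ∃ δ > (0 : ℝ), ∃ c > (0 : ℝ), ∃ C : ℝ,
      ∀ p : unitInterval, (p : ℝ) ≠ 1 / 2 → |(p : ℝ) - 1 / 2| < δ →
        ENNReal.ofReal (c * ((charLength ε p : ℝ) ^ 2 * critOneArmProb (charLength ε p) ^ 2)) ≤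
            triMeanClusterSize p ∧
          triMeanClusterSize p ≤
            ENNReal.ofReal (C * ((charLength ε p : ℝ) ^ 2 * critOneArmProb (charLength ε p) ^ 2))) :
    Tendsto (fun p : ℝ => Real.log (triMeanClusterSizeReal p).toReal / Real.log |p - 1 / 2|)
      (𝓝[≠] (1 / 2)) (𝓝 (-(43 / 18))) := by
  obtain ⟨δ, hδ, c, hc, C, hb⟩ := hχ
  set l : Filter ℝ := 𝓝[≠] (1 / 2) with hl
  set L : ℝ → ℕ := fun p => charLength ε (projIcc (0 : ℝ) 1 zero_le_one p) with hL
  have hLnat : Tendsto L l atTop := tendsto_charLength_atTop_at hK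
  have hLreal : Tendsto (fun p => (L p : ℝ)) l atTop := tendsto_natCast_atTop_iff.2 hLnat
  -- `ν = 4/3` (two-sided) and the one-arm exponent along `L(p)`
  have hν : Tendsto (fun p => Real.log (L p : ℝ) / Real.log |p - 1 / 2|) l (𝓝 (-(4 / 3))) :=
    tendsto_log_charLength_div_log_at h₄ hK
  have hα : Tendsto (fun p => Real.log (critOneArmProb (L p)) / Real.log (L p : ℝ)) l
      (𝓝 (-(5 / 48))) := by
    have h : HasDecayExponent critOneArmProb (5 / 48) := h₁
    exact h.comp hLnat
  -- `|p - 1/2| → 0⁺`, so `log |p - 1/2| → -∞`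
  have habs : Tendsto (fun p : ℝ => |p - 1 / 2|) l (𝓝[>] 0) := by
    refine tendsto_nhdsWithin_iff.2 ⟨?_, ?_⟩
    · have h0 : Tendsto (fun p : ℝ => p - 1 / 2) l (𝓝 0) :=
        (tendsto_nhdsWithin_iff.1 tendsto_sub_half_nhdsNE).1
      have h1 := (continuous_abs.tendsto (0 : ℝ)).comp h0
      rw [abs_zero] at h1
      exact h1
    · filter_upwards [self_mem_nhdsWithin] with p hp
      exact abs_pos.2 (sub_ne_zero.2 hp)
  have hlogp : Tendsto (fun p : ℝ => Real.log |p - 1 / 2|) l atBot :=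
    Real.tendsto_log_nhdsGT_zero.comp habs
  have hneg : ∀ᶠ p in l, Real.log |p - 1 / 2| < 0 := by
    filter_upwards [habs.eventually_mem (Ioo_mem_nhdsGT zero_lt_one)] with p hp
    exact Real.log_neg hp.1 hp.2
  -- eventual facts along `l`
  have hpos1 : ∀ᶠ p in l, 0 < critOneArmProb (L p) := by
    have h : HasDecayExponent critOneArmProb (5 / 48) := h₁
    exact hLnat.eventually (hasDecayExponent_eventually_pos h (by norm_num)
      (fun _ => measureReal_nonneg))
  have hev : ∀ᶠ p in l, 1 < (L p : ℝ) ∧ 0 < critOneArmProb (L p) ∧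
      c * ((L p : ℝ) ^ 2 * critOneArmProb (L p) ^ 2) ≤ (triMeanClusterSizeReal p).toReal ∧
      (triMeanClusterSizeReal p).toReal ≤ C * ((L p : ℝ) ^ 2 * critOneArmProb (L p) ^ 2) := by
    filter_upwards [hLreal.eventually_gt_atTop 1, hpos1, eventually_nhdsNE_half hδ] with p hL1 hπ
      ⟨_, hne, hlt, hval⟩
    have hb' := hb (projIcc (0 : ℝ) 1 zero_le_one p) (by rwa [hval]) (by rwa [hval])
    have hχR : triMeanClusterSizeReal p = triMeanClusterSize (projIcc (0 : ℝ) 1 zero_le_one p) :=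
      rfl
    rw [← hχR] at hb'
    obtain ⟨hlow, hup⟩ := hb'
    have hX : 0 < c * ((L p : ℝ) ^ 2 * critOneArmProb (L p) ^ 2) := by positivity
    -- the upper constant is necessarily positive
    have hCX : 0 < C * ((L p : ℝ) ^ 2 * critOneArmProb (L p) ^ 2) := by
      by_contra hCX
      push Not at hCX
      have h0 : triMeanClusterSizeReal p = 0 := by
        have := hup
        rw [ENNReal.ofReal_of_nonpos hCX] at this
        exact le_antisymm this bot_le
      rw [h0] at hlow
      have : ENNReal.ofReal (c * ((L p : ℝ) ^ 2 * critOneArmProb (L p) ^ 2)) = 0 :=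
        le_antisymm hlow bot_le
      rw [ENNReal.ofReal_eq_zero] at this
      exact absurd this (not_le.2 hX)
    have hfin : triMeanClusterSizeReal p ≠ ∞ := ne_top_of_le_ne_top ENNReal.ofReal_ne_top hup
    exact ⟨hL1, hπ, (ENNReal.ofReal_le_iff_le_toReal hfin).1 hlow,
      ENNReal.toReal_le_of_le_ofReal hCX.le hup⟩
  -- piece 1: `2 log L / log |p - 1/2| → 2 · (-4/3)`
  have h1 : Tendsto (fun p => 2 * (Real.log (L p : ℝ) / Real.log |p - 1 / 2|)) l
      (𝓝 (2 * -(4 / 3))) := hν.const_mul 2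
  -- piece 2: `2 log π₁(L) / log |p - 1/2| → 2 · (-5/48) · (-4/3)`
  have h2 : Tendsto (fun p => Real.log (critOneArmProb (L p)) / Real.log |p - 1 / 2|) l
      (𝓝 (-(5 / 48) * -(4 / 3))) := by
    refine (hα.mul hν).congr' ?_
    filter_upwards [hev] with p ⟨hL1, _, _, _⟩
    have hlogL0 : Real.log (L p : ℝ) ≠ 0 := (Real.log_pos hL1).ne'
    rw [div_mul_div_cancel₀ hlogL0]
  have h2' : Tendsto (fun p => 2 * (Real.log (critOneArmProb (L p)) / Real.log |p - 1 / 2|)) l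
      (𝓝 (2 * (-(5 / 48) * -(4 / 3)))) := h2.const_mul 2
  -- piece 3: the error term `(log χ^f - 2 log L - 2 log π₁(L)) / log |p - 1/2| → 0`
  have h3 : Tendsto (fun p => (Real.log (triMeanClusterSizeReal p).toReal -
      (2 * Real.log (L p : ℝ) + 2 * Real.log (critOneArmProb (L p)))) / Real.log |p - 1 / 2|) l
      (𝓝 0) := by
    have hlow : Tendsto (fun p => Real.log C / Real.log |p - 1 / 2|) l (𝓝 0) :=
      tendsto_const_nhds.div_atBot hlogp
    have hup : Tendsto (fun p => Real.log c / Real.log |p - 1 / 2|) l (𝓝 0) :=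
      tendsto_const_nhds.div_atBot hlogp
    refine tendsto_of_tendsto_of_tendsto_of_le_of_le' hlow hup ?_ ?_
    · filter_upwards [hev, hneg] with p ⟨hL1, hπ, hcle, hCle⟩ hlt
      rw [div_le_div_right_of_neg hlt]
      have hL0 : (0 : ℝ) < (L p : ℝ) := by linarith
      have hX : 0 < (L p : ℝ) ^ 2 * critOneArmProb (L p) ^ 2 := by positivity
      have hχpos : 0 < (triMeanClusterSizeReal p).toReal := (mul_pos hc hX).trans_le hcle
      have hCpos : 0 < C := by
        by_contra hC
        push Not at hC
        nlinarith [hχpos, hCle, hX, hC]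
      have hlogX : Real.log ((L p : ℝ) ^ 2 * critOneArmProb (L p) ^ 2) =
          2 * Real.log (L p : ℝ) + 2 * Real.log (critOneArmProb (L p)) := by
        rw [Real.log_mul (by positivity) (by positivity), Real.log_pow, Real.log_pow]
        push_cast
        ring
      have : Real.log (triMeanClusterSizeReal p).toReal ≤
          Real.log C + Real.log ((L p : ℝ) ^ 2 * critOneArmProb (L p) ^ 2) := by
        rw [← Real.log_mul hCpos.ne' hX.ne']
        exact Real.log_le_log hχpos hCle
      linarith
    · filter_upwards [hev, hneg] with p ⟨hL1, hπ, hcle, _⟩ hlt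
      rw [div_le_div_right_of_neg hlt]
      have hL0 : (0 : ℝ) < (L p : ℝ) := by linarith
      have hX : 0 < (L p : ℝ) ^ 2 * critOneArmProb (L p) ^ 2 := by positivity
      have hlogX : Real.log ((L p : ℝ) ^ 2 * critOneArmProb (L p) ^ 2) =
          2 * Real.log (L p : ℝ) + 2 * Real.log (critOneArmProb (L p)) := by
        rw [Real.log_mul (by positivity) (by positivity), Real.log_pow, Real.log_pow]
        push_cast
        ring
      have : Real.log c + Real.log ((L p : ℝ) ^ 2 * critOneArmProb (L p) ^ 2) ≤
          Real.log (triMeanClusterSizeReal p).toReal := by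
        rw [← Real.log_mul hc.ne' hX.ne']
        exact Real.log_le_log (mul_pos hc hX) hcle
      linarith
  -- conclude: `0 + 2 · (-4/3) + 2 · (-5/48) · (-4/3) = -43/18`
  have h := (h3.add h1).add h2'
  have hlim : (0 : ℝ) + 2 * -(4 / 3) + 2 * (-(5 / 48) * -(4 / 3)) = -(43 / 18) := by norm_num
  rw [hlim] at h
  refine h.congr' ?_
  filter_upwards [hneg] with p hlt
  have ha : Real.log |p - 1 / 2| ≠ 0 := hlt.ne
  field_simp
  ring

/-- **Assembly of crit-perc.S16 (`γ = 43/18`) from its printed ingredients at one `ε`**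
(Smirnov–Werner 2001, §2, Thm. 1 (ii); Nolin 2008, §7.5, Prop. 43 of arXiv 0711.4948 and the
display after it): the one-arm exponent `5/48`, the four-arm exponent `5/4`, Kesten's relation
`|p - 1/2| L_ε² π₄(L_ε) ≍ 1` at `ε` and `χ^f(p) ≍ L_ε(p)² π₁(L_ε(p))²` at `ε` imply
`χ^f(p) = |p - 1/2|^{-43/18 + o(1)}` as `p → 1/2` from either side, i.e.
`triMeanClusterSize_exponent` (`log |p - 1/2| = log (p - 1/2)` on the right, `= log (1/2 - p)` on
the left). [cite: SmirnovWernerMRL2001, §2, Thm. 1 (ii) (arXiv:math/0109120)] [cite: Nolin2008, §7.5, Prop. 43 and the display after it (arXiv 0711.4948 numbering)] -/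
theorem triMeanClusterSize_exponent_of_scaling_at {ε : ℝ} (h₁ : oneArm_exponent)
    (h₄ : fourArm_exponent)
    (hK : ∃ r₁ : ℕ, ∀ r₀ ≥ r₁, ∃ δ > (0 : ℝ), ∃ c > (0 : ℝ), ∃ C : ℝ,
      ∀ p : unitInterval, (p : ℝ) ≠ 1 / 2 → |(p : ℝ) - 1 / 2| < δ →
        c ≤ |(p : ℝ) - 1 / 2| * (charLength ε p : ℝ) ^ 2 * critFourArmProb r₀ (charLength ε p) ∧
          |(p : ℝ) - 1 / 2| * (charLength ε p : ℝ) ^ 2 * critFourArmProb r₀ (charLength ε p) ≤ C)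
    (hχ : ∃ δ > (0 : ℝ), ∃ c > (0 : ℝ), ∃ C : ℝ,
      ∀ p : unitInterval, (p : ℝ) ≠ 1 / 2 → |(p : ℝ) - 1 / 2| < δ →
        ENNReal.ofReal (c * ((charLength ε p : ℝ) ^ 2 * critOneArmProb (charLength ε p) ^ 2)) ≤
            triMeanClusterSize p ∧
          triMeanClusterSize p ≤
            ENNReal.ofReal (C * ((charLength ε p : ℝ) ^ 2 * critOneArmProb (charLength ε p) ^ 2))) :
    triMeanClusterSize_exponent := by
  have h := tendsto_log_triMeanClusterSize_div_log_at h₁ h₄ hK hχ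
  rw [show (-(43 / 18) : ℝ) = -43 / 18 by norm_num] at h
  constructor
  · have h' := h.mono_left (nhdsWithin_mono (1 / 2 : ℝ) (fun p (hp : 1 / 2 < p) => ne_of_gt hp))
    refine h'.congr' (Eventually.of_forall fun p => ?_)
    simp only [Real.log_abs]
  · have h' := h.mono_left (nhdsWithin_mono (1 / 2 : ℝ) (fun p (hp : p < 1 / 2) => ne_of_lt hp))
    refine h'.congr' (Eventually.of_forall fun p => ?_)
    simp only
    rw [← Real.log_abs (1 / 2 - p), abs_sub_comm]

/-- **Assembly of crit-perc.S16 (`γ = 43/18`)** from the one-arm exponent, the four-arm exponent,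
Kesten's relation `Nolin2008_prop34` and Nolin's `χ^f(p) ≍ L_ε(p)² π₁(L_ε(p))²` for every fixed
`ε ∈ (0, 1/2)` (Nolin 2008, §7.5, Prop. 43 of arXiv 0711.4948, "uniformly in `p`"; here on a
punctured neighbourhood of `1/2`, in `ℝ≥0∞`), specialised at `ε = 1/4`
(`triMeanClusterSize_exponent_of_scaling_at`). [cite: SmirnovWernerMRL2001, §2, Thm. 1 (ii) (arXiv:math/0109120)] [cite: Nolin2008, §7.5, Prop. 43 (arXiv 0711.4948 numbering)] -/
theorem triMeanClusterSize_exponent_of_scaling (h₁ : oneArm_exponent) (h₄ : fourArm_exponent)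
    (hK : Nolin2008_prop34)
    (hχ : ∀ ⦃ε : ℝ⦄, 0 < ε → ε < 1 / 2 →
      ∃ δ > (0 : ℝ), ∃ c > (0 : ℝ), ∃ C : ℝ,
        ∀ p : unitInterval, (p : ℝ) ≠ 1 / 2 → |(p : ℝ) - 1 / 2| < δ →
          ENNReal.ofReal (c * ((charLength ε p : ℝ) ^ 2 * critOneArmProb (charLength ε p) ^ 2)) ≤
              triMeanClusterSize p ∧
            triMeanClusterSize p ≤
              ENNReal.ofReal
                (C * ((charLength ε p : ℝ) ^ 2 * critOneArmProb (charLength ε p) ^ 2))) :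
    triMeanClusterSize_exponent :=
  triMeanClusterSize_exponent_of_scaling_at (ε := 1 / 4) h₁ h₄ (hK (by norm_num) (by norm_num))
    (hχ (by norm_num) (by norm_num))

end Literature.Probability.Percolation
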